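import Summits.BirchSwinnertonDyer.BirchSwinnertonDyer.Theorems.GenusKolyvaginAtTwoGenusPrimitiveSupplyAtTwoPosDiscShallowKFourPosHalfPointClass
import HarnessLib

/-!
# Route `GenusKolyvaginAtTwo`, crux K₄⁺ `K4Pos` (stmt-BirchSwinnertonDyer-31469; sign-free, so also K₄ `K4Neg` 31526) —
# THE `2^j`-th-ROOT CLASS: the Kolyvagin cocycle of `Q` when `P(n) = 2^j·Q`, and `ι c_M(Q) = c_{M+j}(P(n))`

Width seat `bsd-line-gk2-p5` g36 (cell `bsd-f1-sign2`), `--supports stmt-BirchSwinnertonDyer-31469 --as helper`.  THEOREMS ONLY (no definition,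
no named fact, no `sorry`).  BSD is NOT proved by this file; nothing is closed.  The `j`-fold version of `…KFourPosHalfPointClass` (`j = 1`),
input of the `j`-fold halving descent `…KFourPosHalvingDescentDepth` (first-block inequality at `2`): if a derived point is `2^j`-divisible,
`P(n) = 2^j·Q` in `E(K[n])`, then McCallum's cocycle of `Q` at level `2^M` (same root as the cocycle of `P(n)` at level `2^{M+j}`) is a class
`x' ∈ H¹(K, E[2^M])` whose change of level is `c_{M+j}(n)` — by the generic identity `map_inclusion_cls_eq_cls_of_zsmul_eq` with `m = 2^j`.
[McCallumLMS1991] §4 Lemma 4.1, (6), Lemma 4.6; [GrossLMS1991] §4 (4.4)–(4.6).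
-/

set_option autoImplicit false
-- the Theorems namespace of this sub repeats the summit name by design (D-0017 nested layout)
set_option linter.dupNamespace false

noncomputable section

open scoped Classical
open scoped AddSubgroup

namespace Summit.BirchSwinnertonDyer.BirchSwinnertonDyer.Theorems.GenusExact.PlusDescent

open WeierstrassCurve NumberField IsDedekindDomain Field Rat.HeightOneSpectrum Literature.NumberTheory.EllipticCurves
  Literature.NumberTheory.GaloisRepresentations Literature.NumberTheory.EllipticCurves.ModularForms AddSubgroup
  Literature.NumberTheory.EllipticCurves.RingClassField
open Literature.NumberTheory.EllipticCurves.KolyvaginCocycle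
open Summit.BirchSwinnertonDyer.BirchSwinnertonDyer.Theses.GenusKolyvaginAtTwo (KolyvaginRelationAtTwo)
open Summit.BirchSwinnertonDyer.Rank1Residual
open Summit.BirchSwinnertonDyer.BirchSwinnertonDyer.Theorems.GenusExact
open Summit.BirchSwinnertonDyer.BirchSwinnertonDyer.Theorems.GenusExact.VisiblePairAtTwo
  (liesOver_of_natCast_mem natCast_mem_primesEquiv_symm natCast_prime_mem_iff_eq hasGoodReductionAt_of_hasGoodReductionAtPrime
    not_mem_range intCast_notMem_of_not_dvd)
open Summit.BirchSwinnertonDyer.BirchSwinnertonDyer.Theorems.OffBigImageOddLocalAtTwo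

/-! ## The class of a `2^j`-th ROOT of a `2^j`-divisible derived point -/

section Heegner

variable {K : Type} [Field K] [NumberField K] {W : WeierstrassCurve ℚ} {Nc : ℕ} [NeZero Nc]
variable {Dt : ModularParametrizationData W Nc} {β : ℤ} {ι : K →+* ℂ} {n : ℕ}

/-- **The `2^j`-th-root class** (the `j`-fold half-point class): for a Heegner datum `d` whose derived point is `2^j`-divisible in `E(K[n])`,
`P(n) = 2^j·Q`, and a level `M` with McCallum's standing inputs AT LEVEL `M+j`, there is a class `x' ∈ H¹(K, E[2^M])` — the Kolyvagin class of
`Q` at level `2^M` — with `ι x' = c_{M+j}(n)` under the change of level `2^M ∣ 2^{M+j}` (an identity of McCallum cocycles with a common root;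
`…KFourPosHalfPointClass` is `j = 1`). [cite: McCallumLMS1991, §4 Lemma 4.1, (6), Lemma 4.6] -/
theorem exists_torsionH1OfDvd_eq_kolyvaginClass_add_of_two_pow_zsmul_eq (d : KolyvaginHeegnerData Dt β ι n) {M j : ℕ}
    (hA1 : IsAdmissible (Field.absoluteGaloisGroup K) d.pointsSubgroup ((2 ^ (M + j) : ℕ) : ℤ))
    (hP1 : d.toGeomPoints d.derivedPoint ∈ invPoints (Field.absoluteGaloisGroup K) d.pointsSubgroup ((2 ^ (M + j) : ℕ) : ℤ))
    {Qh : (W.baseChange (ringClassField K ι n)).toAffine.Point} (hQh : ((2 ^ j : ℕ) : ℤ) • Qh = d.derivedPoint) :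
    ∃ x' : galH1Torsion (W.baseChange K) ((2 ^ M : ℕ) : ℤ),
      torsionH1OfDvd (W.baseChange K) (natCast_pow_dvd_natCast_pow (p := 2) (Nat.le_add_right M j)) x' =
        d.kolyvaginClass Nat.prime_two (M + j) := by
  have hdvd : ((2 ^ M : ℕ) : ℤ) ∣ ((2 ^ (M + j) : ℕ) : ℤ) := natCast_pow_dvd_natCast_pow (p := 2) (Nat.le_add_right M j)
  have hm : ((2 ^ (M + j) : ℕ) : ℤ) = ((2 ^ j : ℕ) : ℤ) * ((2 ^ M : ℕ) : ℤ) := by push_cast; ring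
  have hA0 : IsAdmissible (Field.absoluteGaloisGroup K) d.pointsSubgroup ((2 ^ M : ℕ) : ℤ) := isAdmissible_of_dvd hdvd hA1
  set Q' : geomPoints (W.baseChange K) := d.toGeomPoints Qh with hQ'def
  have hQ'A : Q' ∈ d.pointsSubgroup := ⟨Qh, rfl⟩
  have h2Q' : ((2 ^ j : ℕ) : ℤ) • Q' = d.toGeomPoints d.derivedPoint := by rw [hQ'def, ← map_zsmul, hQh]
  have hQ'inv : Q' ∈ invPoints (Field.absoluteGaloisGroup K) d.pointsSubgroup ((2 ^ M : ℕ) : ℤ) := by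
    refine ⟨hQ'A, fun g ↦ ?_⟩
    obtain ⟨R, hR, hRe⟩ := hP1.2 g
    refine ⟨R, hR, ?_⟩
    have hmemA : ((2 ^ M : ℕ) : ℤ) • R - (g • Q' - Q') ∈ d.pointsSubgroup :=
      d.pointsSubgroup.sub_mem (d.pointsSubgroup.zsmul_mem hR _) (d.pointsSubgroup.sub_mem (hA1.smul_mem g hQ'A) hQ'A)
    have hzero : ((2 ^ (M + j) : ℕ) : ℤ) • (((2 ^ M : ℕ) : ℤ) • R - (g • Q' - Q')) = 0 := by
      have h2 : ((2 ^ j : ℕ) : ℤ) • (((2 ^ M : ℕ) : ℤ) • R - (g • Q' - Q')) = 0 := by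
        rw [zsmul_sub, smul_smul, ← hm, hRe, zsmul_sub, ← smul_zsmul_comm, h2Q', sub_self]
      rw [hm, mul_comm, mul_smul, h2, zsmul_zero]
    exact sub_eq_zero.mp (hA1.eq_zero_of_zsmul hmemA hzero)
  have hdivM : ∀ P : geomPoints (W.baseChange K), ∃ R : geomPoints (W.baseChange K), ((2 ^ M : ℕ) : ℤ) • R = P :=
    (W.baseChange K).zsmul_geomPoints_surjective_of_charZero (by positivity)
  obtain ⟨R₀, hR₀⟩ := hdivM Q'
  have hR₀' : ((2 ^ (M + j) : ℕ) : ℤ) • R₀ = d.toGeomPoints d.derivedPoint := by rw [hm, mul_smul, hR₀, h2Q']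
  refine ⟨Literature.NumberTheory.EllipticCurves.kolyvaginClass (W.baseChange K) ((2 ^ M : ℕ) : ℤ) hdivM hA0 Q' hQ'inv, ?_⟩
  rw [d.kolyvaginClass_of_admissible Nat.prime_two (M + j) hA1 hP1,
    kolyvaginClass_eq_cls hA0 hQ'inv hR₀, kolyvaginClass_eq_cls hA1 hP1 hR₀']
  exact map_inclusion_cls_eq_cls_of_zsmul_eq hm (geomTorsion_le_of_dvd (W.baseChange K) hdvd) hA1 hA0
    (continuous_smul_geomPoints (W.baseChange K)) hQ'inv hP1 h2Q' hR₀ hR₀'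

end Heegner

end Summit.BirchSwinnertonDyer.BirchSwinnertonDyer.Theorems.GenusExact.PlusDescent

end
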